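import Summits.BirchSwinnertonDyer.Rank1Residual.Additive.RamifiedOrdinaryLineQuotientInvariants
import Summits.BirchSwinnertonDyer.Rank1Residual.Additive.TwistedOrdinaryLineOfTwist
import Literature.NumberTheory.EllipticCurves.GreenbergVatsal2000.ResidualSelmerGroups
import HarnessLib

/-!
# The FLIPPED intrinsic line at `p = 3`: `C[3] = E[3]^{I_3}` for the ramified ordinary line of an
# additive potentially ordinary / potentially multiplicative prime `3` — the hypotheses `hfix` / `hmax`
# of `GreenbergVatsalTransferRamifiedQuotient` DISCHARGED on the cell's `p = 3` rows from cc-typer-1's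
# `TwistedOrdinaryLineAt` (TB-TOL) and FILE 4's `D^{ker κ ⊓ I} = 0`
# (cell `b2b-bsdres`, team n1011, seat p12 (gen 4); row T-E3g-GV29 FILE 5)

HONEST FRAMING (cell `b2b-bsdres`, run/shared/lean/b2b/bsd-rank1-residual/, verbatim in every
file): the goal of the cell is to DELETE the COMBINATION-SHAPED residual classes of the
Birch–Swinnerton-Dyer formula for ALL analytic-rank `≤ 1` elliptic curves over `ℚ` — "full BSD
formula for every rank `≤ 1` curve in class `C`" assembled STRICTLY from published theorems — so
that the rank-`≤ 1` remainder becomes exactly the CONSTRUCTION-SHAPED classes, which are TYPED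
(missing-input `Prop`s), NOT attempted. This is not "finishing BSD". Team n1011: research routes on
CONSTRUCTION-SHAPED classes; prove what is provable now; no claim beyond stated classes; census
output = EVIDENCE, never a Literature fact; RESIDUAL-MAP marks UNCHANGED; nothing is booked by this
file. THEOREMS ONLY: no definition, no named fact; cc-typer-1's `Additive/MixedCongruenceTameness`,
`Additive/TwistedOrdinaryLineOfTwist` and the GV vocabulary are consumed BY NAME.

## What and why

FILE 2 (`GreenbergVatsalTransferRamifiedQuotient`) compares `S^{Σ₀}_{E₁[p^∞]}` and `S^{Σ₀}_{E₂[p^∞]}`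
along ANY `Γ`-isomorphism `θ : E₁[p] ≃ E₂[p]` provided the data are intrinsic in the FLIPPED sense:
`E_i[p] ∩ C_i = E_i[p]^{I_v}` (`hfix` — inertia fixes `C_i[p]` pointwise; `hmax` — every `I_v`-fixed
`p`-torsion point lies in `C_i`). At an additive prime of semistability defect `e = 2`,
`C[p]|_{I} = ω^{(p+1)/2}`: this line is UNRAMIFIED exactly when `p = 3` (ROUTE-2 II.15.4; cc-typer-1's
`TwistedOrdinaryLineAt W 3 I` = "an `I`-FIXED line with `I` moving the quotient", proved on the cell's
(G-ord) twist models and (mod A40/A41) (M) twist models at `3`, `Additive/TwistedOrdinaryLineOfTwist`).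

* §1 `not_torsionBy_le_plus` — for a divisible proper `C ⊂ E[p^∞]`, `E[p^∞][p] ⊄ C` (else
  `E[p^k] ⊆ C` for all `k` by divisibility); `mem_torsionDatum_plus_of_forall_inertia_smul_eq` — **`hmax`
  from FILE 4's `h0`**: an `I_v`-fixed `p`-torsion point has `I_v`-fixed class in `D`, hence lies in
  `C` (ANY odd `p`, any `H`);
* §2 `forall_inertia_smul_torsionDatum_eq_of_twistedOrdinaryLineAt` — **`hfix` at `p`** from
  `TwistedOrdinaryLineAt W p (inertia v)` + `h0` + `#E[p] = p²`: the fixed line `Y` of TB-TOL, carried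
  into `E[p^∞][p]`, lies in `C` (§1), and `C ∩ E[p]` is a proper subgroup of `E[p]` of order `≥ p`, so
  `C ∩ E[p] = Y` is fixed pointwise;
* §3 the cell's `p = 3` rows: `ClassX4Gord/ClassX3Gord.exists_isRamifiedOrdinaryLine_flipped_three`
  (unconditional) and `ClassX4M/ClassX3M.…` (mod A40/A41): a ramified ordinary line at `v ∋ 3` with
  `D^{ker κ ⊓ I_v} = 0`, `I_v` fixing `C ∩ E[3]` pointwise, and `E[3]^{I_v} ⊆ C` — ALL local hypotheses
  of FILES 1–2 discharged on N10/N11's `p = 3` rows.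

References: [GreenbergVatsal2000] §2 p. 26 ("`C[p]` … is determined by the action of `I_p`") and
Remark (2.9); [Serre1972] §1.11; cc-typer-1 `MixedCongruenceTameness.TwistedOrdinaryLineAt`;
ROUTE-2 II.15.4 (the flip at `p = 3`).
-/

set_option autoImplicit false

noncomputable section

open scoped Classical NumberField AddSubgroup

open NumberField IsDedekindDomain Field WeierstrassCurve
  Literature.NumberTheory.GaloisRepresentations Literature.NumberTheory.EllipticCurves
  Literature.NumberTheory.EllipticCurves.GreenbergSelmer
  Literature.NumberTheory.EllipticCurves.GreenbergVatsal2000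
  Literature.NumberTheory.EllipticCurves.EmertonPollackWeston2006
  Literature.NumberTheory.EllipticCurves.Rank1Residual
  Summit.BirchSwinnertonDyer.Rank1Residual.X2.TorsionComparison
  Summit.BirchSwinnertonDyer.Rank1Residual.X2.GreenbergVatsalTorsion
  Summit.BirchSwinnertonDyer.Rank1Residual.Additive.MixedCongruence

universe u

namespace Summit.BirchSwinnertonDyer.Rank1Residual.Additive

/-! ### §1 `E[p^∞][p] ⊄ C`; `hmax` from `h0` -/

section Generic

variable {p : ℕ} [hp : Fact p.Prime] {v : HeightOneSpectrum (𝓞 ℚ)} {W : WeierstrassCurve ℚ}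
  (L : LocalDatum ℚ (W.geomPrimaryTorsion p) v)

omit hp in
/-- A divisible subgroup `C ⊆ E[p^∞]` containing `E[p^∞][p]` is everything: `p^{k+1} m = 0 ⟹ p m ∈ C`
(induction) `⟹ p m = p c`, `c ∈ C ⟹ m − c ∈ E[p] ⊆ C`. [folklore] -/
theorem plus_eq_top_of_torsionBy_le (hdiv : ∀ m ∈ L.plus, ∃ m' ∈ L.plus, p • m' = m)
    (hle : (W.geomPrimaryTorsion p)[(p : ℤ)] ≤ L.plus) : L.plus = ⊤ := by
  have key : ∀ (k : ℕ) (m : W.geomPrimaryTorsion p), p ^ k • m = 0 → m ∈ L.plus := by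
    intro k
    induction k with
    | zero => intro m hm; rw [pow_zero, one_smul] at hm; rw [hm]; exact L.plus.zero_mem
    | succ k ih =>
      intro m hm
      have hpm : p • m ∈ L.plus := ih (p • m) (by rw [smul_smul, ← pow_succ, hm])
      obtain ⟨c, hc, hpc⟩ := hdiv _ hpm
      have hmc : m - c ∈ (W.geomPrimaryTorsion p)[(p : ℤ)] := by
        rw [AddSubgroup.torsionBy.nsmul_iff, smul_sub, ← hpc, sub_self]
      have := hle hmc
      simpa using L.plus.add_mem this hc
  refine eq_top_iff.2 fun m _ ↦ ?_
  obtain ⟨k, hk⟩ := (AddCommGroup.mem_primaryComponent).1 m.2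
  exact key k m (Subtype.ext (by rw [AddSubmonoidClass.coe_nsmul, hk]; rfl))

omit hp in
/-- **`E[p^∞][p] ⊄ C`** for a divisible PROPER `C` (e.g. an `IsRamifiedOrdinaryLine`). [folklore] -/
theorem not_torsionBy_le_plus (hdiv : ∀ m ∈ L.plus, ∃ m' ∈ L.plus, p • m' = m) (htop : L.plus ≠ ⊤) :
    ¬ (W.geomPrimaryTorsion p)[(p : ℤ)] ≤ L.plus :=
  fun hle ↦ htop (plus_eq_top_of_torsionBy_le L hdiv hle)

omit hp in
/-- **`hmax` from `h0`**: if `(E[p^∞]/C)^{H ⊓ I_v} = 0`, every `p`-torsion point FIXED by the inertia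
group `I_v` lies in `C ∩ E[p^∞][p]` (its class in `E[p^∞]/C` is fixed by `H ⊓ I_v ⊆ I_v`).
[cite: GreenbergVatsal2000, §2 Remark (2.9) and p. 26] -/
theorem mem_torsionDatum_plus_of_forall_inertia_smul_eq (H : Subgroup (absoluteGaloisGroup ℚ))
    (h0 : ∀ a ∈ invariants (inertiaIn H v) L.Gr, a = 0)
    (x : (W.geomPrimaryTorsion p)[(p : ℤ)]) (hx : ∀ τ ∈ inertia v, τ • x = x) :
    x ∈ (torsionDatum L p).plus := by
  change (x : W.geomPrimaryTorsion p) ∈ L.plus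
  rw [← L.ker_grMk, AddMonoidHom.mem_ker]
  refine h0 _ ((mem_invariants_iff _).2 fun g ↦ ?_)
  have hgI : ((g : decomp (K := ℚ) v) : absoluteGaloisGroup ℚ) ∈ inertia v :=
    ((mem_inertiaIn_iff H v g.1).1 g.2).2
  rw [Subgroup.smul_def, LocalDatum.smul_grMk]
  congr 1
  have h := congrArg (fun y : (W.geomPrimaryTorsion p)[(p : ℤ)] ↦ (y : W.geomPrimaryTorsion p)) (hx _ hgI)
  exact h

end Generic

/-! ### §2 `hfix` from a twisted ordinary line (`C ∩ E[p] = ` TB-TOL's fixed line) -/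

section Fixed

variable {p : ℕ} [hp : Fact p.Prime] {v : HeightOneSpectrum (𝓞 ℚ)} {W : WeierstrassCurve ℚ} [W.IsElliptic]
  (L : LocalDatum ℚ (W.geomPrimaryTorsion p) v)

omit hp [W.IsElliptic] in
/-- `torsionToPrimary : E(ℚ̄)[p] → E[p^∞][p]` is `Γ_ℚ`-equivariant (both actions are the restriction of
the action on `E(ℚ̄)`). [folklore] -/
theorem torsionToPrimary_smul' (g : absoluteGaloisGroup ℚ) (P : geomTorsion W (p : ℤ)) :
    torsionToPrimary W p (g • P) = g • torsionToPrimary W p P :=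
  Subtype.ext (Subtype.ext rfl)

omit hp [W.IsElliptic] in
/-- `torsionToPrimary` is injective (it is an inclusion of subgroups of `E(ℚ̄)`). [folklore] -/
theorem torsionToPrimary_injective : Function.Injective (torsionToPrimary W p) := by
  intro P Q h
  have h' := congrArg (fun y : (W.geomPrimaryTorsion p)[(p : ℤ)] ↦ ((y : W.geomPrimaryTorsion p) : W.geomPoints)) h
  exact Subtype.ext h'

omit hp [W.IsElliptic] in
/-- `torsionToPrimary` is surjective: a `p`-torsion element of `E[p^∞]` is a `p`-torsion point. [folklore] -/
theorem torsionToPrimary_surjective : Function.Surjective (torsionToPrimary W p) := by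
  intro y
  have hy : ((y : W.geomPrimaryTorsion p) : W.geomPoints) ∈ geomTorsion W (p : ℤ) := by
    rw [AddSubgroup.torsionBy.nsmul_iff]
    have h1 : p • (y : W.geomPrimaryTorsion p) = 0 := by
      rw [← AddSubgroupClass.coe_nsmul, AddSubgroup.torsionBy.nsmul y]; rfl
    rw [← AddSubmonoidClass.coe_nsmul, h1]; rfl
  exact ⟨⟨_, hy⟩, Subtype.ext (Subtype.ext rfl)⟩

/-- `#E[p^∞][p] = p²` (`#E(ℚ̄)[p] = p²`, Silverman AEC III.6.4(b), along `torsionToPrimary`).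
[cite: SilvermanAEC2009, Cor. III.6.4(b)] -/
theorem natCard_torsionBy_geomPrimaryTorsion : Nat.card ((W.geomPrimaryTorsion p)[(p : ℤ)]) = p ^ 2 := by
  have hp0 : ((p : ℕ) : AlgebraicClosure ℚ) ≠ 0 := by exact_mod_cast hp.out.ne_zero
  rw [← card_torsionPoints_eq_sq_holds W (AlgebraicClosure ℚ) hp0]
  exact (Nat.card_eq_of_bijective _ ⟨torsionToPrimary_injective, torsionToPrimary_surjective⟩).symm

/-- **`hfix` from TB-TOL**: if `E[p]` has an `I_v`-FIXED line `Y` (cc-typer-1's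
`TwistedOrdinaryLineAt W p (inertia v)`), `C` is divisible and proper, and `(E[p^∞]/C)^{H ⊓ I_v} = 0`,
then `I_v` fixes `C ∩ E[p^∞][p]` pointwise — indeed `C ∩ E[p] = Y`: `Y ⊆ C` (§1 `hmax`), `#Y = p`,
and `C ∩ E[p]` is a proper subgroup of `E[p]` (order `p²`). GV p. 26's "determined by the action of `I_p`",
flipped. [cite: GreenbergVatsal2000, §2 p. 26] [cite: Serre1972, §1.11] -/
theorem forall_inertia_smul_torsionDatum_eq_of_twistedOrdinaryLineAt
    (hT : TwistedOrdinaryLineAt W p (inertia v))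
    (hdiv : ∀ m ∈ L.plus, ∃ m' ∈ L.plus, p • m' = m) (htop : L.plus ≠ ⊤)
    (H : Subgroup (absoluteGaloisGroup ℚ)) (h0 : ∀ a ∈ invariants (inertiaIn H v) L.Gr, a = 0) :
    ∀ τ ∈ inertia v, ∀ c ∈ (torsionDatum L p).plus, τ • c = c := by
  obtain ⟨Y, hYcard, hYfix, -⟩ := hT
  -- `Y' = torsionToPrimary(Y) ⊆ C ∩ E[p]`
  set Y' : AddSubgroup ((W.geomPrimaryTorsion p)[(p : ℤ)]) := Y.map (torsionToPrimary W p) with hY'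
  have hY'le : Y' ≤ (torsionDatum L p).plus := by
    rintro _ ⟨P, hP, rfl⟩
    refine mem_torsionDatum_plus_of_forall_inertia_smul_eq L H h0 _ fun τ hτ ↦ ?_
    rw [← torsionToPrimary_smul', hYfix τ hτ P hP]
  have hY'card : Nat.card Y' = p := by
    rw [hY', Nat.card_congr (Y.equivMapOfInjective _ torsionToPrimary_injective).toEquiv.symm]
    exact hYcard
  -- `C ∩ E[p]` is proper of order dividing `p²`, and contains `Y'` of order `p`: so it IS `Y'`
  haveI : Finite ((W.geomPrimaryTorsion p)[(p : ℤ)]) :=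
    Nat.finite_of_card_ne_zero
      (by rw [natCard_torsionBy_geomPrimaryTorsion]; exact pow_ne_zero _ hp.out.ne_zero)
  have hne : (torsionDatum L p).plus ≠ ⊤ := by
    intro htop'
    refine not_torsionBy_le_plus L hdiv htop fun x hx ↦ ?_
    have : (⟨x, hx⟩ : (W.geomPrimaryTorsion p)[(p : ℤ)]) ∈ (torsionDatum L p).plus := by
      rw [htop']; exact AddSubgroup.mem_top _
    exact this
  have hdvd : Nat.card (torsionDatum L p).plus ∣ p ^ 2 := by
    rw [← natCard_torsionBy_geomPrimaryTorsion (W := W) (p := p)]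
    exact AddSubgroup.card_addSubgroup_dvd_card _
  have hle_card : p ≤ Nat.card (torsionDatum L p).plus := by
    have h := AddSubgroup.card_le_of_le hY'le
    rwa [hY'card] at h
  have hcardT : Nat.card (torsionDatum L p).plus = p := by
    obtain ⟨i, hi, hci⟩ := (Nat.dvd_prime_pow hp.out).1 hdvd
    interval_cases i
    · rw [pow_zero] at hci
      rw [hci] at hle_card
      exact absurd hle_card (not_le.2 hp.out.one_lt)
    · rw [hci, pow_one]
    · exfalso
      refine hne (AddSubgroup.eq_top_of_card_eq _ ?_)
      rw [hci, natCard_torsionBy_geomPrimaryTorsion]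
  have hYeq : Y' = (torsionDatum L p).plus :=
    AddSubgroup.eq_of_le_of_card_ge hY'le (by rw [hY'card, hcardT])
  -- conclude
  intro τ hτ c hc
  rw [← hYeq] at hc
  obtain ⟨P, hP, rfl⟩ := hc
  rw [← torsionToPrimary_smul', hYfix τ hτ P hP]

end Fixed

/-! ### §3 The cell's `p = 3` rows: all local hypotheses of FILES 1–2 discharged -/

section Three

variable [Fact (Nat.Prime 3)] {W : WeierstrassCurve ℚ} [W.IsElliptic] [W.IsGloballyMinimal]
  (κ : ZpExtension ℚ 3) {v : HeightOneSpectrum (𝓞 ℚ)}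

/-- **X4♯(G-ord) at `3` (`e = 2` automatic): a ramified ordinary line `C` at `v ∋ 3` with
`(E[3^∞]/C)^{ker κ ⊓ I_v} = 0`, `I_v` FIXING `C ∩ E[3]` pointwise, and `E[3]^{I_v} ⊆ C`** — FILES 1–2's
`h0`, `hplus`, `hfix`, `hmax` ALL discharged on the N11 (G-ord) rows (FILE 4 + cc-typer-1's TB-TOL
`twistedOrdinaryLineAt_three_of_goodOrd_twist_model` at the tree's prime `adicCompletionPrime ℚ v`).
X4♯ stays CONSTRUCTION-SHAPED; nothing booked. [cite: GreenbergVatsal2000, §2 Remark (2.9) and p. 26]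
[cite: Serre1972, §1.11 Prop. 11] -/
theorem ClassX4Gord.exists_isRamifiedOrdinaryLine_flipped_three (hX : ClassX4Gord W 3)
    (hpv : ((3 : ℕ) : 𝓞 ℚ) ∈ v.asIdeal) :
    ∃ L : LocalDatum ℚ ↥(W.geomPrimaryTorsion 3) v, IsRamifiedOrdinaryLine W 3 L ∧
      (∀ a ∈ invariants (inertiaIn κ.kerSubgroup v) L.Gr, a = 0) ∧
      (∀ τ ∈ inertia v, ∀ c ∈ (torsionDatum L 3).plus, τ • c = c) ∧
      (∀ x : (W.geomPrimaryTorsion 3)[((3 : ℕ) : ℤ)], (∀ τ ∈ inertia v, τ • x = x) →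
        x ∈ (torsionDatum L 3).plus) := by
  have he : semistabilityIndex W 3 = 2 :=
    semistabilityIndex_eq_two_of_typeG_three W hX.typeGOrd.typeG hX.addv.2
  obtain ⟨V, _, _, C, hord, hC⟩ := ClassX4Gord.exists_goodOrd_pStar_twist_model W 3 hX he
  obtain ⟨L, hL, h0⟩ :=
    exists_isRamifiedOrdinaryLine_gr_invariants_eq_zero_of_goodOrd_pStar_twist 3 κ hX.addv.1 V ⟨C, hC⟩
      hord hpv
  have hC' : C • V.quadraticTwist (-3 : ℚ) = W := by
    have e : ((-1 : ℚ) ^ ((3 : ℕ) / 2) * (3 : ℕ)) = -3 := by norm_num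
    rw [← e]; exact hC
  have hT : TwistedOrdinaryLineAt W 3 (inertia v) := by
    have h := twistedOrdinaryLineAt_three_of_goodOrd_twist_model (W := W) hord.1 hord.2 C hC' hpv
      (adicCompletionPrime_mem_primesAbove ℚ v)
    rwa [inertia_adicCompletionPrime_eq_map_absInertia] at h
  exact ⟨L, hL, h0,
    forall_inertia_smul_torsionDatum_eq_of_twistedOrdinaryLineAt L hT (fun _ hm ↦ hL.divisible hm)
      hL.plus_ne_top _ h0,
    fun x hx ↦ mem_torsionDatum_plus_of_forall_inertia_smul_eq L _ h0 x hx⟩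

/-- **X3♯(G-ord) at `3` (REDUCIBLE `E[3]`): the same four conclusions.** [cite: GreenbergVatsal2000, §2 Remark (2.9) and p. 26]
[cite: Serre1972, §1.11 Prop. 11] -/
theorem ClassX3Gord.exists_isRamifiedOrdinaryLine_flipped_three (hX : ClassX3Gord W 3)
    (hpv : ((3 : ℕ) : 𝓞 ℚ) ∈ v.asIdeal) :
    ∃ L : LocalDatum ℚ ↥(W.geomPrimaryTorsion 3) v, IsRamifiedOrdinaryLine W 3 L ∧
      (∀ a ∈ invariants (inertiaIn κ.kerSubgroup v) L.Gr, a = 0) ∧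
      (∀ τ ∈ inertia v, ∀ c ∈ (torsionDatum L 3).plus, τ • c = c) ∧
      (∀ x : (W.geomPrimaryTorsion 3)[((3 : ℕ) : ℤ)], (∀ τ ∈ inertia v, τ • x = x) →
        x ∈ (torsionDatum L 3).plus) := by
  have h32 : (3 : ℕ) ≠ 2 := by decide
  have he : semistabilityIndex W 3 = 2 :=
    semistabilityIndex_eq_two_of_typeG_three W hX.typeGOrd.typeG hX.addv
  obtain ⟨V, _, _, C, hord, hC⟩ := ClassX3Gord.exists_goodOrd_pStar_twist_model W 3 h32 hX he
  obtain ⟨L, hL, h0⟩ :=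
    exists_isRamifiedOrdinaryLine_gr_invariants_eq_zero_of_goodOrd_pStar_twist 3 κ h32 V ⟨C, hC⟩ hord hpv
  have hC' : C • V.quadraticTwist (-3 : ℚ) = W := by
    have e : ((-1 : ℚ) ^ ((3 : ℕ) / 2) * (3 : ℕ)) = -3 := by norm_num
    rw [← e]; exact hC
  have hT : TwistedOrdinaryLineAt W 3 (inertia v) := by
    have h := twistedOrdinaryLineAt_three_of_goodOrd_twist_model (W := W) hord.1 hord.2 C hC' hpv
      (adicCompletionPrime_mem_primesAbove ℚ v)
    rwa [inertia_adicCompletionPrime_eq_map_absInertia] at h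
  exact ⟨L, hL, h0,
    forall_inertia_smul_torsionDatum_eq_of_twistedOrdinaryLineAt L hT (fun _ hm ↦ hL.divisible hm)
      hL.plus_ne_top _ h0,
    fun x hx ↦ mem_torsionDatum_plus_of_forall_inertia_smul_eq L _ h0 x hx⟩

end Three

end Summit.BirchSwinnertonDyer.Rank1Residual.Additive

end
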